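import Summits.Ventures.HodgeRepro2.T6ExteriorDuality

/-!
# T6ExteriorDualityGraded — graded Poincaré duality and degree lemmas for `⋀ M`

Carrier-free, over `T6ExteriorDuality`. `pairingEquiv_symm_mem`: a functional on `⋀ M` that vanishes on
every `⋀^j M`, `j ≠ d`, is represented (through `pairingEquiv`) by an element of `⋀^(dim M - d) M`.
Also: `mul_mem_exteriorPower` (degrees add), `map_mem_exteriorPower_of_ι` (an algebra endomorphism
sending `ι v` into degree one preserves every degree), `eq_zero_of_forall_comp` (a functional vanishing
on every homogeneous component vanishes). Used by the lead's toy `TransferShadow` (README §10.5(ii)(c),(d)).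
§8(d): uses an L-value-free non-vanishing device: NO.
-/

namespace Summit.Ventures.HodgeRepro2.T6.ExteriorDuality

open ExteriorAlgebra DirectSum

variable {F : Type*} [Field F] {M : Type*} [AddCommGroup M] [Module F M]
variable {I : Type*} [Fintype I] [LinearOrder I] (b : Module.Basis I F M)

omit [Fintype I] in
/-- Homogeneous pieces multiply into the sum degree (`⋀^i * ⋀^j ⊆ ⋀^(i+j)`). -/
lemma mul_mem_exteriorPower {i j : ℕ} {x y : ExteriorAlgebra F M} (hx : x ∈ ⋀[F]^i M)
    (hy : y ∈ ⋀[F]^j M) : x * y ∈ ⋀[F]^(i + j) M :=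
  SetLike.mul_mem_graded hx hy

/-- The `i`-th homogeneous component of `p` (as an element of the algebra). -/
noncomputable abbrev comp (p : ExteriorAlgebra F M) (i : ℕ) : ExteriorAlgebra F M :=
  (DirectSum.decompose (fun i : ℕ => ⋀[F]^i M) p i : ExteriorAlgebra F M)

omit [Fintype I] in
/-- The `i`-th component is homogeneous of degree `i`. -/
lemma comp_mem (p : ExteriorAlgebra F M) (i : ℕ) : comp p i ∈ ⋀[F]^i M := SetLike.coe_mem _

omit [Fintype I] in
/-- A component outside the support of the decomposition vanishes. -/
lemma comp_eq_zero_of_notMem_support [DecidableEq (ExteriorAlgebra F M)]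
    [∀ i, DecidableEq (⋀[F]^i M)] {p : ExteriorAlgebra F M} {i : ℕ}
    (h : i ∉ (DirectSum.decompose (fun i : ℕ => ⋀[F]^i M) p).support) :
    DirectSum.decompose (fun i : ℕ => ⋀[F]^i M) p i = 0 := by
  simpa using h

omit [Fintype I] in
/-- A linear functional vanishing on every homogeneous component vanishes. -/
lemma eq_zero_of_forall_comp {φ : Module.Dual F (ExteriorAlgebra F M)}
    (h : ∀ (i : ℕ) (u : ExteriorAlgebra F M), u ∈ ⋀[F]^i M → φ u = 0) : φ = 0 := by
  classical
  refine LinearMap.ext fun p => ?_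
  rw [← DirectSum.sum_support_decompose (fun i : ℕ => ⋀[F]^i M) p, map_sum]
  exact Finset.sum_eq_zero fun i _ => h i _ (SetLike.coe_mem _)

/-- `topCoeff (x * u) = 0` for homogeneous `x`, `u` of degrees not summing to `dim M`. -/
lemma topCoeff_mul_of_ne {i j : ℕ} (hij : i + j ≠ Fintype.card I) {x u : ExteriorAlgebra F M}
    (hx : x ∈ ⋀[F]^i M) (hu : u ∈ ⋀[F]^j M) : topCoeff b (x * u) = 0 :=
  topCoeff_of_mem_of_ne b hij (mul_mem_exteriorPower hx hu)

/-- GRADED POINCARÉ DUALITY: a functional supported in degree `d` (vanishing on every `⋀^j`,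
`j ≠ d`) is represented by an element of degree `dim M - d`. -/
theorem pairingEquiv_symm_mem (φ : Module.Dual F (ExteriorAlgebra F M)) (d : ℕ)
    (hφ : ∀ j ≠ d, ∀ u ∈ ⋀[F]^j M, φ u = 0) :
    (pairingEquiv b).symm φ ∈ ⋀[F]^(Fintype.card I - d) M := by
  classical
  set N := Fintype.card I with hN
  set p := (pairingEquiv b).symm φ with hp
  -- every component of `p` in a degree `i ≠ N - d` vanishes
  have hcomp : ∀ i, i ≠ N - d → comp p i = 0 := by
    intro i hi
    apply pairingMap_injective b
    rw [map_zero]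
    apply eq_zero_of_forall_comp
    intro j u hu
    rw [pairingMap_apply]
    by_cases hij : i + j = N
    · -- the pairing of `comp p i` with `u ∈ ⋀^j` is `φ u`, which vanishes as `j ≠ d`
      have hjd : j ≠ d := by omega
      have hφu : φ u = 0 := hφ j hjd u hu
      have hpu : topCoeff b (p * u) = φ u := topCoeff_pairingEquiv_symm_mul b φ u
      have hsum : topCoeff b (p * u) = topCoeff b (comp p i * u) := by
        conv_lhs => rw [← DirectSum.sum_support_decompose (fun i : ℕ => ⋀[F]^i M) p,
          Finset.sum_mul, map_sum]
        rw [Finset.sum_eq_single i]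
        · intro k _ hk
          exact topCoeff_mul_of_ne b (by omega) (comp_mem p k) hu
        · intro hnot
          simp [comp_eq_zero_of_notMem_support hnot]
      rw [← hsum, hpu, hφu]
    · exact topCoeff_mul_of_ne b hij (comp_mem p i) hu
  rw [← DirectSum.sum_support_decompose (fun i : ℕ => ⋀[F]^i M) p, Finset.sum_eq_single (N - d)]
  · exact comp_mem p _
  · intro k _ hk
    exact hcomp k hk
  · intro hnot
    simp [comp_eq_zero_of_notMem_support hnot]

omit [Fintype I] in
/-- An algebra endomorphism of `⋀ M` sending `ι v` into `⋀^1` preserves every degree. -/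
lemma map_mem_exteriorPower_of_ι (g : ExteriorAlgebra F M →ₐ[F] ExteriorAlgebra F M)
    (hg : ∀ v, g (ι F v) ∈ ⋀[F]^1 M) {k : ℕ} {u : ExteriorAlgebra F M} (hu : u ∈ ⋀[F]^k M) :
    g u ∈ ⋀[F]^k M := by
  induction k generalizing u with
  | zero =>
    rw [exteriorPower, pow_zero, Submodule.mem_one] at hu ⊢
    obtain ⟨r, rfl⟩ := hu
    exact ⟨r, (g.commutes r).symm⟩
  | succ k ih =>
    rw [exteriorPower, pow_succ] at hu
    refine Submodule.mul_induction_on hu ?_ ?_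
    · intro m hm n hn
      obtain ⟨v, rfl⟩ := LinearMap.mem_range.mp hn
      rw [map_mul]
      exact mul_mem_exteriorPower (ih hm) (hg v)
    · intro x y hx hy
      rw [map_add]
      exact Submodule.add_mem _ hx hy

omit [Fintype I] in
/-- `ι v` has degree one. -/
lemma ι_mem_exteriorPower_one (v : M) : ι F v ∈ ⋀[F]^1 M := by
  rw [exteriorPower, pow_one]
  exact LinearMap.mem_range_self _ v

omit [Fintype I] in
/-- `1` has degree zero. -/
lemma one_mem_exteriorPower_zero : (1 : ExteriorAlgebra F M) ∈ ⋀[F]^0 M :=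
  SetLike.one_mem_graded _

end Summit.Ventures.HodgeRepro2.T6.ExteriorDuality
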